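import Literature.MathematicalPhysics.QuantumFieldTheory.Balaban1983to89.B9Eq324PenaltyKernelForm
import Literature.MathematicalPhysics.QuantumFieldTheory.Balaban1983to89.B9Eq337LogChartFlatBase

/-!
# `Balaban1983to89.B9Eq360LaplacePrimeAkLaw` — T. Bałaban, *Propagators for lattice gauge theories in a background field*, Commun. Math. Phys. **99** (1985)
# 389–434 [Balaban1985BackgroundPropagators] (3.60) p. 402 with (3.53) p. 400, (3.24)–(3.25) p. 394, Thm 3.4 p. 400: **THE EXACT LAW
# `Δ′_{a′,k}(U′V) = Δ′_{a′,k}(V) − V′(A)` FOR THE NE9 CHAIN's `k`-LEVEL SITE OPERATOR, WITH THE SECT. B PROGRAMME's CONCRETE `V′(A) = vPrimeConc`** — read in `𝔸`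
# (`readA`), for ANY two backgrounds related by print's left chart `U = e^{iηA}·V` (bondwise), with r06's letters `kQ := k_Q(V)`, `kF := k_Q(U) − k_Q(V)`, `sQ := s_Q(V)`,
# `sF := s_Q(U) − s_Q(V)`, `cfun ≡ a′`; specialised to the FLAT BASE `V ≡ 1`, `A = (iη)⁻¹log U`; with the two-sided inverse `readA G′_k` and the realified statement
# (`conj b`) in the exact hypothesis shape `hmul`∕uniqueness of `B9Thm34SectBUniform(R1).thm34_Gp_uniform` — junction item (j3) of the NE9 lineage's route memo
# `ROUTE-J-VIA-THM34-g98.md`, completed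

statement-level skeleton of published theorems with citation tags; proofs where landed; nothing here is a claim about the Yang–Mills mass gap

CITATION HEADER (lean-in-tree rule).  Audit cell `pub-balaban`, sub-cell `t4`, BINDER row NE9; NE9 crux-team LEAF PROVER 01 (`b2b-balaban-t4-ne9-formalise-leaf-01`,
gen 99; bears_on: R4/N22).  Vocabulary BY NAME: this lineage's `B9Eq324PenaltyKernelForm` (`readA`, `readA_*`, `sQ`, `readA_covLaplaceSiteK_apply`,
`readA_penalty_sub_penalty_eq_avgOp`), `B9Eq357QprimeTowerKernelForm` (`blkK`, `kQ`), `B9Eq337LogChartFlatBase.prodCfg_one_logChart` (g98), r06's `B9Eq352ScalarFluct.eq353`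
((3.53) EXACT), `B9Eq352GradLetters.V1pOp` ∕ `V1pOp_apply`, `B9Eq360VprimeLetters.vPrimeConc` ∕ `vPrimeConc_eq`, `B9Eq352DivFormLetters.conj` ∕ `conj_mul` ∕ `conj_sub`,
`B9Eq39Adjoint.prodCfg`, the chain's `B9Eq324DeltaPrimeATower.laplacePrimeAk` ∕ `GpOfUk`, `B11Eq103H1Complex.comp_greenK` ∕ `greenK_comp`.  Source read in the held text
`paper:balaban1985-cmp99-background-propagators` (journal page = PDF page + 388) through those files' verbatim quotations: p. 402 (3.60) «Combining (3.53) and (3.59) we get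
Δ_{U′U} + Q′*(U′U)aQ′(U′U) = Δ_U + Q′*(U)aQ′(U) − V′₁(A) + F′₂*(A)aQ′(U) + Q′*(U)aF′₂(A) + F′₂*(A)aF′₂(A) = Δ_U + Q′*(U)aQ′(U) − V′(A)», p. 400 (3.53), p. 394
(3.24)–(3.25).  [folklore] algebra between two encodings of the same printed operators; NOTHING of print's estimates is asserted.

WHAT IS PROVED (sorry-free; proof lane — no `def`).
* §1 **`readA_covLaplaceSiteK_prodCfg`** — (3.53) for the chain: `readA Δ^η_U = readA Δ^η_V − V′₁(A)` (`V1pOp` at the dictionary `T μ := shiftEquiv μ`, base `V(·, μ)`) whenever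
  `U(x, μ) = (e^{iηA}V)_μ(x)` (`prodCfg`); `η ≠ 0`.
* §2 **`readA_laplacePrimeAk_law`** — (3.60) for the chain, EXACT: `readA Δ′_{a′,k}(U) = readA Δ′_{a′,k}(V) − vPrimeConc T V η A blkK k_Q(V) (k_Q(U) − k_Q(V)) s_Q(V)
  (s_Q(U) − s_Q(V)) a′`.
* §3 **`readA_laplacePrimeAk_law_flatBase`** — the same at `V ≡ 1`, `A := (iη)⁻¹·log U` (print's left chart of a background with `‖U(b) − 1‖ < 1`; `prodCfg_one_logChart`).
* §4 `laplacePrimeAk_comp_GpOfUk` ∕ `GpOfUk_comp_laplacePrimeAk`, **`readA_laplacePrimeAk_mul_GpOfUk`** ∕ **`readA_GpOfUk_mul_laplacePrimeAk`** (`readA Δ′·readA G′ = 1 = readA G′·readA Δ′`),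
  `conj_one`, **`conj_readA_law`** (the realified law: `conj b (readA Δ′(U)) = conj b (readA Δ′(V)) − conj b (vPrimeConc …)` — the `Δp − conj b (vPrimeConc …)` of
  `thm34_Gp_uniform` IS the chain's `Δ′_{a′,k}(U)` when `Δp := conj b (readA Δ′_{a′,k}(V))`), **`conj_readA_GpOfUk_inverse`** (`Δp·Gp = 1 = Gp·Δp` for
  `Gp := conj b (readA G′_k(V))`), **`eq_conj_readA_GpOfUk_of_inverse`** (uniqueness: any two-sided inverse of `conj b (readA Δ′_{a′,k}(U))` — e.g. r06's `gPrimeExtEnd` —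
  IS `conj b (readA G′_k(U))`).
HONEST SCOPE.  Exact finite-dimensional algebra; the SIZES ((3.58)∕(3.59) letters `hkF`∕`hsF` with `C_qα₁`, the (3.37) bounds of `A`, Thm 3.1's block majorants at the
base) are other files (`B9Eq357QprimeTowerKernelForm.norm_kF_le`, `B9Eq324PenaltyKernelForm.norm_sQ_sub_sQ_one_le`, `B9Eq337LogChartFlatBase.logChart_bounds_flatBase`; the
base majorants: next); the geometry instance (j1) is not here; NE9 NOT PRINTED ∕ NOT PROVED; spine PROVED 0∕9; rung (B)+1 finite T⁴ — NOT infinite volume, NOT mass gap, NOT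
BetaPertH, NOT Clay.  HONEST DEPENDENCY: continuum YM on T⁴ ⇐ BetaPertH ∧ nine spine estimates (0/9 proved); BetaPertH ⇐ (D1) ∧ (D4) ∧ CAP+tail; G-an2-4 gates asym, D1 and
NE2/3/4.  NEW file; nothing modified.  RELATED, NOT DUPLICATED: pub-ymgap's `B9Eq360DeltaPrimeAY.eq360_deltaPrimeAY` (the same law for NODE 00's operator `deltaPrimeAY` on
its own carrier).  Net new unproved facts: 0.
-/

noncomputable section

open scoped BigOperators InnerProductSpace

namespace Literature.MathematicalPhysics.QuantumFieldTheory.Balaban1983to89.B9Eq360LaplacePrimeAkLaw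

open Complex (I)
open B4Sect5Torus (TSite)
open B9SectCLatticeCarrier (Bond)
open B9Eq315QTower (towerP UlevOf)
open B9Eq311L2Pairing (WL2)
open B11Eq103H1Complex (SiteL2K covLaplaceSiteK comp_greenK greenK_comp)
open B9Eq310HessianOperator (adTransportW)
open B9Eq33CovDerivVector (adTransport shiftEquiv)
open B9Eq324DeltaPrimeATower (laplacePrimeAk GpOfUk)
open B9Eq324PenaltyKernelForm (readA readA_apply readA_comp readA_sub readA_id readA_covLaplaceSiteK_apply readA_penalty_sub_penalty_eq_avgOp sQ)
open B9Eq357QprimeTowerKernelForm (blkK kQ)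
open B9Eq39Adjoint (prodCfg)
open B9Eq352ScalarFluct (siteLap eq353)
open B9Eq352GradLetters (V1pOp V1pOp_apply)
open B9Eq360VprimeLetters (vPrimeConc vPrimeConc_eq)
open B9Eq352DivFormLetters (conj conj_sub)
open B9Eq337LogChartFlatBase (prodCfg_one_logChart)
open MatrixLog (mlog)

/-! ## §1 (3.53) for the chain's covariant Laplacian read in `𝔸` -/

section Laplacian

variable {d : ℕ} {P : Fin d → ℕ} {𝔸 : Type*} [NormedRing 𝔸] [NormedAlgebra ℂ 𝔸] [CompleteSpace 𝔸] {W : Type*} [NormedAddCommGroup W] [InnerProductSpace ℂ W]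
  (φ : W ≃ₗ[ℂ] 𝔸) {c₀ : ℝ} [Fact (0 < c₀)] {η : ℝ} (hη : η ≠ 0) (U V : Bond d P → 𝔸ˣ) (A : Fin d → TSite d P → 𝔸)
  (hUV : (fun μ y => U (y, μ)) = prodCfg (fun μ y => V (y, μ)) η A)
include hη hUV

/-- **(3.53) FOR THE CHAIN: `readA Δ^η_U = readA Δ^η_V − V′₁(A)`** whenever `U = e^{iηA}·V` bondwise (print's left chart `U′U₀`): r06's EXACT `eq353` at the dictionary
`T μ := shiftEquiv μ`, through `readA_covLaplaceSiteK_apply`. [cite: Balaban1985BackgroundPropagators, (3.53) p.400, (3.23) p.394] -/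
theorem readA_covLaplaceSiteK_prodCfg :
    readA φ (covLaplaceSiteK (c₀ := c₀) ((η : ℂ))⁻¹ (adTransportW φ U) (adTransportW φ fun b => (U b)⁻¹)) =
      readA φ (covLaplaceSiteK (c₀ := c₀) ((η : ℂ))⁻¹ (adTransportW φ V) (adTransportW φ fun b => (V b)⁻¹)) -
        V1pOp (fun μ => shiftEquiv (Pd := P) μ) (fun μ y => V (y, μ)) η A := by
  apply LinearMap.ext; intro f; funext x
  rw [LinearMap.sub_apply, Pi.sub_apply, readA_covLaplaceSiteK_apply, readA_covLaplaceSiteK_apply, hUV, eq353,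
    V1pOp_apply _ _ η hη]

end Laplacian

/-! ## §2 (3.60) for the chain's `k`-level site operator, EXACT -/

section Law

variable {d : ℕ} (L : ℕ) [NeZero L] (m : Fin d → ℕ) [∀ i, NeZero (m i)] (n : ℕ)
  {𝔸 : Type*} [NormedRing 𝔸] [NormedAlgebra ℂ 𝔸] [CompleteSpace 𝔸] [FiniteDimensional ℂ 𝔸]
  {W : Type*} [NormedAddCommGroup W] [InnerProductSpace ℂ W] [FiniteDimensional ℂ W] (φ : W ≃ₗ[ℂ] 𝔸)
  {c₀ : ℝ} [Fact (0 < c₀)] {c₁ : ℝ} [Fact (0 < c₁)] {η : ℝ} (U V : Bond d (towerP L m (n + 1)) → 𝔸ˣ) (a' : ℝ)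

/-- **(3.60) FOR THE CHAIN, EXACT: `readA Δ′_{a′,k}(U) = readA Δ′_{a′,k}(V) − V′(A)`** with the Sect. B programme's CONCRETE
`V′(A) = vPrimeConc T V η A blkK k_Q(V) (k_Q(U) − k_Q(V)) s_Q(V) (s_Q(U) − s_Q(V)) a′` ((3.52)'s `V′₁(A)` minus the three averaging words), whenever `U = e^{iηA}·V` bondwise —
«Combining (3.53) and (3.59) we get … = Δ_U + Q′*(U)aQ′(U) − V′(A), (3.60)». [cite: Balaban1985BackgroundPropagators, (3.60) p.402, (3.53) p.400, (3.24) p.394] -/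
theorem readA_laplacePrimeAk_law (hη : η ≠ 0) (A : Fin d → TSite d (towerP L m (n + 1)) → 𝔸)
    (hUV : (fun μ y => U (y, μ)) = prodCfg (fun μ y => V (y, μ)) η A) :
    readA φ (laplacePrimeAk L m n φ η U a' (c₀ := c₀) (c₁ := c₁)) =
      readA φ (laplacePrimeAk L m n φ η V a' (c₀ := c₀) (c₁ := c₁)) -
        vPrimeConc (fun μ => shiftEquiv (Pd := towerP L m (n + 1)) μ) (fun μ y => V (y, μ)) η A (blkK L m n)
          (kQ L m n (fun j => adTransport (𝕜 := ℂ) (UlevOf L m (n + 1) V j)))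
          (kQ L m n (fun j => adTransport (𝕜 := ℂ) (UlevOf L m (n + 1) U j)) - kQ L m n (fun j => adTransport (𝕜 := ℂ) (UlevOf L m (n + 1) V j)))
          (sQ L m n φ V (c₀ := c₀) (c₁ := c₁)) (sQ L m n φ U (c₀ := c₀) (c₁ := c₁) - sQ L m n φ V (c₀ := c₀) (c₁ := c₁)) (fun _ : TSite d m => a') := by
  have hpen := readA_penalty_sub_penalty_eq_avgOp L m n φ η U V a' (c₀ := c₀) (c₁ := c₁)
  have hlap := readA_covLaplaceSiteK_prodCfg φ (c₀ := c₀) hη U V A hUV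
  rw [readA_sub, readA_sub, hlap] at hpen
  rw [vPrimeConc_eq, ← hpen]
  abel

/-- **(3.60) AT THE FLAT BASE**: for a background with `‖U(b) − 1‖ < 1` and `0 < η`, with print's left chart `A := (iη)⁻¹·log U` (so `e^{iηA}·1 = U`,
`prodCfg_one_logChart`): `readA Δ′_{a′,k}(U) = readA Δ′_{a′,k}(1) − vPrimeConc T 1 η A blkK k_Q(1) (k_Q(U) − k_Q(1)) s_Q(1) (s_Q(U) − s_Q(1)) a′` — the vacuum comparison
of the NE9 chain in the Sect. B programme's exact perturbative form. [cite: Balaban1985BackgroundPropagators, (3.60) p.402, p.390, Thm 3.4 p.400] -/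
theorem readA_laplacePrimeAk_law_flatBase (hη : 0 < η) (hU1 : ∀ b, ‖(U b : 𝔸) - 1‖ < 1) :
    readA φ (laplacePrimeAk L m n φ η U a' (c₀ := c₀) (c₁ := c₁)) =
      readA φ (laplacePrimeAk L m n φ η (fun _ : Bond d (towerP L m (n + 1)) => (1 : 𝔸ˣ)) a' (c₀ := c₀) (c₁ := c₁)) -
        vPrimeConc (fun μ => shiftEquiv (Pd := towerP L m (n + 1)) μ) (1 : Fin d → TSite d (towerP L m (n + 1)) → 𝔸ˣ) η
          (fun μ y => ((I * η : ℂ))⁻¹ • mlog (U (y, μ) : 𝔸)) (blkK L m n)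
          (kQ L m n (fun j => adTransport (𝕜 := ℂ) (UlevOf L m (n + 1) (fun _ : Bond d (towerP L m (n + 1)) => (1 : 𝔸ˣ)) j)))
          (kQ L m n (fun j => adTransport (𝕜 := ℂ) (UlevOf L m (n + 1) U j)) -
            kQ L m n (fun j => adTransport (𝕜 := ℂ) (UlevOf L m (n + 1) (fun _ : Bond d (towerP L m (n + 1)) => (1 : 𝔸ˣ)) j)))
          (sQ L m n φ (fun _ : Bond d (towerP L m (n + 1)) => (1 : 𝔸ˣ)) (c₀ := c₀) (c₁ := c₁))
          (sQ L m n φ U (c₀ := c₀) (c₁ := c₁) - sQ L m n φ (fun _ : Bond d (towerP L m (n + 1)) => (1 : 𝔸ˣ)) (c₀ := c₀) (c₁ := c₁))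
          (fun _ : TSite d m => a') := by
  have h1 : (fun μ (y : TSite d (towerP L m (n + 1))) => ((fun _ : Bond d (towerP L m (n + 1)) => (1 : 𝔸ˣ)) (y, μ))) =
      (1 : Fin d → TSite d (towerP L m (n + 1)) → 𝔸ˣ) := rfl
  have hUV : (fun μ (y : TSite d (towerP L m (n + 1))) => U (y, μ)) =
      prodCfg (fun μ (y : TSite d (towerP L m (n + 1))) => ((fun _ : Bond d (towerP L m (n + 1)) => (1 : 𝔸ˣ)) (y, μ))) η
        (fun μ y => ((I * η : ℂ))⁻¹ • mlog (U (y, μ) : 𝔸)) := by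
    rw [h1, prodCfg_one_logChart (fun μ y => U (y, μ)) hη (fun μ y => hU1 (y, μ))]
  have h := readA_laplacePrimeAk_law L m n φ U (fun _ => 1) a' (c₀ := c₀) (c₁ := c₁) hη.ne' _ hUV
  rw [h1] at h
  exact h

end Law

/-! ## §4 The two-sided inverse `readA G′_k`, the realified law, and uniqueness -/

section Inverse

variable {d : ℕ} (L : ℕ) [NeZero L] (m : Fin d → ℕ) [∀ i, NeZero (m i)] (n : ℕ)
  {𝔸 : Type*} [NormedRing 𝔸] [NormedAlgebra ℂ 𝔸] [CompleteSpace 𝔸] [FiniteDimensional ℂ 𝔸]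
  {W : Type*} [NormedAddCommGroup W] [InnerProductSpace ℂ W] [FiniteDimensional ℂ W] (φ : W ≃ₗ[ℂ] 𝔸)
  {c₀ : ℝ} [Fact (0 < c₀)] {c₁ : ℝ} [Fact (0 < c₁)] (η : ℝ) (U : Bond d (towerP L m (n + 1)) → 𝔸ˣ) (a' : ℝ)
  (hpos' : ∀ x : SiteL2K ℂ d (towerP L m (n + 1)) c₀ W, x ≠ 0 → 0 < RCLike.re ⟪x, laplacePrimeAk L m n φ η U a' (c₀ := c₀) (c₁ := c₁) x⟫_ℂ)

omit [FiniteDimensional ℂ 𝔸] in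
/-- `Δ′_{a′,k}(U) ∘ G′_k(U) = id` (`B11Eq103H1Complex.comp_greenK`). [cite: Balaban1985BackgroundPropagators, (3.25) p.394] -/
theorem laplacePrimeAk_comp_GpOfUk : laplacePrimeAk L m n φ η U a' (c₀ := c₀) (c₁ := c₁) ∘ₗ GpOfUk L m n φ η U a' hpos' = LinearMap.id := comp_greenK hpos'

omit [FiniteDimensional ℂ 𝔸] in
/-- `G′_k(U) ∘ Δ′_{a′,k}(U) = id` (`B11Eq103H1Complex.greenK_comp`). [cite: Balaban1985BackgroundPropagators, (3.25) p.394] -/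
theorem GpOfUk_comp_laplacePrimeAk : GpOfUk L m n φ η U a' hpos' ∘ₗ laplacePrimeAk L m n φ η U a' (c₀ := c₀) (c₁ := c₁) = LinearMap.id := greenK_comp hpos'

omit [FiniteDimensional ℂ 𝔸] in
/-- **`readA Δ′_{a′,k}(U) · readA G′_k(U) = 1`.** [cite: Balaban1985BackgroundPropagators, (3.24)–(3.25) p.394] -/
theorem readA_laplacePrimeAk_mul_GpOfUk : readA φ (laplacePrimeAk L m n φ η U a' (c₀ := c₀) (c₁ := c₁)) * readA φ (GpOfUk L m n φ η U a' hpos') = 1 := by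
  rw [← readA_comp, laplacePrimeAk_comp_GpOfUk, readA_id]

omit [FiniteDimensional ℂ 𝔸] in
/-- **`readA G′_k(U) · readA Δ′_{a′,k}(U) = 1`.** [cite: Balaban1985BackgroundPropagators, (3.24)–(3.25) p.394] -/
theorem readA_GpOfUk_mul_laplacePrimeAk : readA φ (GpOfUk L m n φ η U a' hpos') * readA φ (laplacePrimeAk L m n φ η U a' (c₀ := c₀) (c₁ := c₁)) = 1 := by
  rw [← readA_comp, GpOfUk_comp_laplacePrimeAk, readA_id]

variable {ι : Type} [Fintype ι] (b : Module.Basis ι ℝ 𝔸)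

omit [CompleteSpace 𝔸] [FiniteDimensional ℂ 𝔸] in
/-- `conj b 1 = 1` (realification is unital). [folklore] [cite: Balaban1984PropagatorsII, (2.52) p.232] -/
theorem conj_one {S : Type} [Fintype S] : conj (S := S) b 1 = 1 := by
  rw [conj, Module.End.one_eq_id, LinearEquiv.conj_id, Module.End.one_eq_id]

omit [FiniteDimensional ℂ 𝔸] in
/-- **THE REALIFIED INVERSE PAIR**: `Δp := conj b (readA Δ′_{a′,k}(U))`, `Gp := conj b (readA G′_k(U))` satisfy `Δp·Gp = 1 = Gp·Δp` — the hypotheses `hΔpGp`, `hGpΔp` of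
`B9Thm34SectBUniform(R1).thm34_Gp_uniform` at the chain's base operator. [cite: Balaban1985BackgroundPropagators, (3.24)–(3.25) p.394, Thm 3.4 p.400] -/
theorem conj_readA_GpOfUk_inverse :
    conj b (readA φ (laplacePrimeAk L m n φ η U a' (c₀ := c₀) (c₁ := c₁))) * conj b (readA φ (GpOfUk L m n φ η U a' hpos')) = 1 ∧
    conj b (readA φ (GpOfUk L m n φ η U a' hpos')) * conj b (readA φ (laplacePrimeAk L m n φ η U a' (c₀ := c₀) (c₁ := c₁))) = 1 := by
  rw [← B9Eq352DivFormLetters.conj_mul, ← B9Eq352DivFormLetters.conj_mul, readA_laplacePrimeAk_mul_GpOfUk, readA_GpOfUk_mul_laplacePrimeAk, conj_one]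
  exact ⟨rfl, rfl⟩

variable (V : Bond d (towerP L m (n + 1)) → 𝔸ˣ)

omit hpos' in
/-- **THE REALIFIED LAW**: `conj b (readA Δ′_{a′,k}(U)) = conj b (readA Δ′_{a′,k}(V)) − conj b (vPrimeConc …)` — i.e. the operator `Δp − conj b (vPrimeConc T V η A blk kQ kF sQ sF cfun)`
that `thm34_Gp_uniform` inverts IS the chain's `Δ′_{a′,k}(U)` (realified, read in `𝔸`) when `Δp := conj b (readA Δ′_{a′,k}(V))` and `U = e^{iηA}·V`.
[cite: Balaban1985BackgroundPropagators, (3.60) p.402, Thm 3.4 p.400] -/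
theorem conj_readA_law (hη : η ≠ 0) (A : Fin d → TSite d (towerP L m (n + 1)) → 𝔸)
    (hUV : (fun μ y => U (y, μ)) = prodCfg (fun μ y => V (y, μ)) η A) :
    conj b (readA φ (laplacePrimeAk L m n φ η U a' (c₀ := c₀) (c₁ := c₁))) =
      conj b (readA φ (laplacePrimeAk L m n φ η V a' (c₀ := c₀) (c₁ := c₁))) -
        conj b (vPrimeConc (fun μ => shiftEquiv (Pd := towerP L m (n + 1)) μ) (fun μ y => V (y, μ)) η A (blkK L m n)
          (kQ L m n (fun j => adTransport (𝕜 := ℂ) (UlevOf L m (n + 1) V j)))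
          (kQ L m n (fun j => adTransport (𝕜 := ℂ) (UlevOf L m (n + 1) U j)) - kQ L m n (fun j => adTransport (𝕜 := ℂ) (UlevOf L m (n + 1) V j)))
          (sQ L m n φ V (c₀ := c₀) (c₁ := c₁)) (sQ L m n φ U (c₀ := c₀) (c₁ := c₁) - sQ L m n φ V (c₀ := c₀) (c₁ := c₁)) (fun _ : TSite d m => a')) := by
  rw [← conj_sub, ← readA_laplacePrimeAk_law L m n φ U V a' hη A hUV]

omit [FiniteDimensional ℂ 𝔸] in
/-- **UNIQUENESS: any two-sided inverse of `conj b (readA Δ′_{a′,k}(U))` IS `conj b (readA G′_k(U))`** — so r06's extension `gPrimeExtEnd Gp (V′Gp)`, which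
`thm34_Gp_uniform` proves to be such an inverse, equals the chain's own (realified) `G′_k(U)`, and its block majorants are majorants of `G′_k(U)`.
[folklore] [cite: Balaban1985BackgroundPropagators, (3.64)–(3.65) p.402–403, (3.25) p.394] -/
theorem eq_conj_readA_GpOfUk_of_inverse (E : Module.End ℝ ((TSite d (towerP L m (n + 1))) × ι → ℝ))
    (hE : conj b (readA φ (laplacePrimeAk L m n φ η U a' (c₀ := c₀) (c₁ := c₁))) * E = 1) :
    E = conj b (readA φ (GpOfUk L m n φ η U a' hpos')) := by
  obtain ⟨-, h2⟩ := conj_readA_GpOfUk_inverse L m n φ η U a' hpos' b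
  calc E = (conj b (readA φ (GpOfUk L m n φ η U a' hpos')) * conj b (readA φ (laplacePrimeAk L m n φ η U a' (c₀ := c₀) (c₁ := c₁)))) * E := by
        rw [h2, one_mul]
    _ = conj b (readA φ (GpOfUk L m n φ η U a' hpos')) := by rw [mul_assoc, hE, mul_one]

end Inverse

end Literature.MathematicalPhysics.QuantumFieldTheory.Balaban1983to89.B9Eq360LaplacePrimeAkLaw

end
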